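import Summits.CriticalPhenomena.CardyFormulaZ2.Theses.CardyMagicRigidity
import Literature.Probability.Percolation.CardyFormulaConformalInvariance
import Literature.Probability.Percolation.BoxCrossingUpperBound
import Literature.Probability.Percolation.ZdNearCriticalWindow
import Literature.Probability.Percolation.HalfSpacePinnedPairs
import Literature.Probability.Percolation.SharpnessDCTProofs
import Literature.Probability.RandomPlanarGeometry.ConformalRectangleProofs
import Literature.Probability.Percolation.TriChartDuality

/-!
# Stub `stub_triPlateDuality` of line `oracle-sandwich` (crux `LoopsToCrossings`)

Planar duality with room for the plate events of site percolation on `δ𝕋` read in a chart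
`Φ : ℂ ≃ₜ ℂ` (stub C-G2 of the skeleton
`Summits/CriticalPhenomena/CardyFormulaZ2/Cruxes/LoopsToCrossings/Lines/oracle-sandwich.lean`):
if no open `𝕋`-path drawn in the plate `Φ([-x,x] × [-yout,yout])` joins `Φ{im ≤ -yin}` to
`Φ{yin ≤ im}`, then some closed `𝕋`-path drawn in `Φ([-x,x] × [-(yin+2ν), yin+2ν])` joins
`Φ{re ≤ -(x-2ν)}` to `Φ{x-2ν ≤ re}`; the same with open/closed exchanged, and the two transposed
forms.  All four are instances of the chart-rectangle duality of
`Literature.Probability.Percolation.tri_chart_duality_v` / `tri_chart_duality_h`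
(`TriChartDuality.lean`: continuum duality in a rectangle + Voronoi cells of `δ𝕋`) for the
rectangles `[-(x-ν), x-ν] × [-(yin+ν), yin+ν]`, resp. `[-(xin+ν), xin+ν] × [-(y-ν), y-ν]`, and the
colour classes `ω`, `ωᶜ`; the threshold `δ₀` depends on `Φ` and `ν` only.
-/

noncomputable section

namespace Summit.CriticalPhenomena.CardyFormulaZ2.Cruxes.LoopsToCrossings.OracleSandwich

open Summit.CriticalPhenomena.CardyFormulaZ2.Theses.CardyMagicRigidity
open Literature.Probability.RandomPlanarGeometry hiding cardyFunction
open Literature.Probability.Percolation hiding cardyFunction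
open Literature.Probability.LatticeModels
open Filter Topology Set MeasureTheory Metric

/-- A point whose chart coordinate lies in `Z` lies in `Φ(Z)`. [folklore] -/
private theorem mem_image_of_symm_mem {Φ : ℂ ≃ₜ ℂ} {p : ℂ} {Z : Set ℂ} (h : Φ.symm p ∈ Z) :
    p ∈ Φ '' Z := by
  rw [Homeomorph.image_eq_preimage_symm]; exact h

/-- A `𝕋`-path of sites of `B` read in a chart box `X ⊆ Y` is a `B`-connection inside the plate
`Φ(Y)`. [folklore] -/
private theorem mem_siteConnIn_of_pathIn {Φ : ℂ ≃ₜ ℂ} {δ : ℝ} {B : Set (Site 2)} {X Y : Set ℂ}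
    (hXY : X ⊆ Y) {u w : Site 2}
    (h : PathIn triGraph ({v : Site 2 | Φ.symm (triMeshPoint δ v) ∈ X} ∩ B) u w) :
    B ∈ siteConnIn triGraph {v : Site 2 | triMeshPoint δ v ∈ Φ '' Y} u w := by
  refine PathIn.mem_siteConnIn (h.mono ?_)
  rintro v ⟨hv, hvB⟩
  exact ⟨mem_image_of_symm_mem (hXY hv), hvB⟩

/-- **Stub C-G2 — planar duality with room for plate events on `𝕋`** (X-free, deterministic).
Site percolation on `𝕋` at mesh `δ` (sites drawn by `triMeshPoint δ`, paths = `siteConnIn triGraph`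
restricted to a site set; the closed paths of `ω` are the open paths of `ωᶜ`): for a chart `Φ` and a
room `ν > 0`, for all small `δ` and every `ω`: if NO open path drawn inside the plate
`Φ([-x,x] × [-yout,yout])` joins `Φ{im ≤ -yin}` to `Φ{yin ≤ im}`, then SOME closed path drawn inside
`Φ([-x,x] × [-(yin+2ν), yin+2ν])` joins `Φ{re ≤ -(x-2ν)}` to `Φ{x-2ν ≤ re}`; the same with
open/closed exchanged; and the two transposed forms.  Proof: the chart-rectangle duality with room
`tri_chart_duality_v` (resp. `tri_chart_duality_h`) for the rectangle
`[-(x-ν), x-ν] × [-(yin+ν), yin+ν]` (resp. `[-(xin+ν), xin+ν] × [-(y-ν), y-ν]`) and the colour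
class `ω` (resp. `ωᶜ`): its first alternative is an open plate crossing of the hypothesis' plate
(excluded), its second one is the wanted closed crossing; continuum duality in a rectangle
(cut-wire theorem + Janiszewski) with the Voronoi cells of the open sites as obstacle.
[cite: BollobasRiordan2006, Ch. 7 Lemma 5 p. 169] -/
theorem stub_triPlateDuality :
    ∀ (Φ : ℂ ≃ₜ ℂ) (ν : ℝ), 0 < ν → ∃ δ₀ : ℝ, 0 < δ₀ ∧ ∀ δ : ℝ, 0 < δ → δ ≤ δ₀ →
      ∀ ω : SiteConfig (Site 2),
        (∀ x yin yout : ℝ, 2 * ν < x → x ≤ 2 → 0 < yin → yin + 2 * ν ≤ yout → yout ≤ 2 →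
          ((¬ ∃ u ∈ {w : Site 2 | triMeshPoint δ w ∈ Φ '' {z : ℂ | z.im ≤ -yin}},
                ∃ v ∈ {w : Site 2 | triMeshPoint δ w ∈ Φ '' {z : ℂ | yin ≤ z.im}},
                  ω ∈ siteConnIn triGraph {w | triMeshPoint δ w ∈ Φ '' (Icc (-x) x ×ℂ Icc (-yout) yout)} u v) →
            ∃ u ∈ {w : Site 2 | triMeshPoint δ w ∈ Φ '' {z : ℂ | z.re ≤ -(x - 2 * ν)}},
              ∃ v ∈ {w : Site 2 | triMeshPoint δ w ∈ Φ '' {z : ℂ | x - 2 * ν ≤ z.re}},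
                ωᶜ ∈ siteConnIn triGraph
                  {w | triMeshPoint δ w ∈ Φ '' (Icc (-x) x ×ℂ Icc (-(yin + 2 * ν)) (yin + 2 * ν))} u v) ∧
          ((¬ ∃ u ∈ {w : Site 2 | triMeshPoint δ w ∈ Φ '' {z : ℂ | z.im ≤ -yin}},
                ∃ v ∈ {w : Site 2 | triMeshPoint δ w ∈ Φ '' {z : ℂ | yin ≤ z.im}},
                  ωᶜ ∈ siteConnIn triGraph {w | triMeshPoint δ w ∈ Φ '' (Icc (-x) x ×ℂ Icc (-yout) yout)} u v) →
            ∃ u ∈ {w : Site 2 | triMeshPoint δ w ∈ Φ '' {z : ℂ | z.re ≤ -(x - 2 * ν)}},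
              ∃ v ∈ {w : Site 2 | triMeshPoint δ w ∈ Φ '' {z : ℂ | x - 2 * ν ≤ z.re}},
                ω ∈ siteConnIn triGraph
                  {w | triMeshPoint δ w ∈ Φ '' (Icc (-x) x ×ℂ Icc (-(yin + 2 * ν)) (yin + 2 * ν))} u v)) ∧
        (∀ xin xout y : ℝ, 2 * ν < y → y ≤ 2 → 0 < xin → xin + 2 * ν ≤ xout → xout ≤ 2 →
          ((¬ ∃ u ∈ {w : Site 2 | triMeshPoint δ w ∈ Φ '' {z : ℂ | z.re ≤ -xin}},
                ∃ v ∈ {w : Site 2 | triMeshPoint δ w ∈ Φ '' {z : ℂ | xin ≤ z.re}},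
                  ω ∈ siteConnIn triGraph {w | triMeshPoint δ w ∈ Φ '' (Icc (-xout) xout ×ℂ Icc (-y) y)} u v) →
            ∃ u ∈ {w : Site 2 | triMeshPoint δ w ∈ Φ '' {z : ℂ | z.im ≤ -(y - 2 * ν)}},
              ∃ v ∈ {w : Site 2 | triMeshPoint δ w ∈ Φ '' {z : ℂ | y - 2 * ν ≤ z.im}},
                ωᶜ ∈ siteConnIn triGraph
                  {w | triMeshPoint δ w ∈ Φ '' (Icc (-(xin + 2 * ν)) (xin + 2 * ν) ×ℂ Icc (-y) y)} u v) ∧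
          ((¬ ∃ u ∈ {w : Site 2 | triMeshPoint δ w ∈ Φ '' {z : ℂ | z.re ≤ -xin}},
                ∃ v ∈ {w : Site 2 | triMeshPoint δ w ∈ Φ '' {z : ℂ | xin ≤ z.re}},
                  ωᶜ ∈ siteConnIn triGraph {w | triMeshPoint δ w ∈ Φ '' (Icc (-xout) xout ×ℂ Icc (-y) y)} u v) →
            ∃ u ∈ {w : Site 2 | triMeshPoint δ w ∈ Φ '' {z : ℂ | z.im ≤ -(y - 2 * ν)}},
              ∃ v ∈ {w : Site 2 | triMeshPoint δ w ∈ Φ '' {z : ℂ | y - 2 * ν ≤ z.im}},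
                ω ∈ siteConnIn triGraph
                  {w | triMeshPoint δ w ∈ Φ '' (Icc (-(xin + 2 * ν)) (xin + 2 * ν) ×ℂ Icc (-y) y)} u v)) := by

  intro Φ ν hν
  obtain ⟨δ₁, hδ₁, hV⟩ := tri_chart_duality_v Φ hν 2
  obtain ⟨δ₂, hδ₂, hH⟩ := tri_chart_duality_h Φ hν 2
  refine ⟨min δ₁ δ₂, lt_min hδ₁ hδ₂, fun δ hδ hδle ω =>
    ⟨fun x yin yout hx hx2 hyin hyio hyout => ?_, fun xin xout y hy hy2 hxin hxio hxout => ?_⟩⟩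
  · -- vertical hypothesis, horizontal conclusion
    have hδ₁' : δ ≤ δ₁ := hδle.trans (min_le_left _ _)
    have hbox₁ : Icc (-(x - ν) - ν) (x - ν + ν) ×ℂ Icc (-(yin + ν) - ν) (yin + ν + ν) ⊆
        Icc (-x) x ×ℂ Icc (-yout) yout := fun z hz =>
      ⟨⟨by linarith [hz.1.1], by linarith [hz.1.2]⟩, ⟨by linarith [hz.2.1], by linarith [hz.2.2]⟩⟩
    have hbox₂ : Icc (-(x - ν) - ν) (x - ν + ν) ×ℂ Icc (-(yin + ν) - ν) (yin + ν + ν) ⊆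
        Icc (-x) x ×ℂ Icc (-(yin + 2 * ν)) (yin + 2 * ν) := fun z hz =>
      ⟨⟨by linarith [hz.1.1], by linarith [hz.1.2]⟩, ⟨by linarith [hz.2.1], by linarith [hz.2.2]⟩⟩
    have key : ∀ B : Set (Site 2),
        (¬ ∃ u ∈ {w : Site 2 | triMeshPoint δ w ∈ Φ '' {z : ℂ | z.im ≤ -yin}},
            ∃ v ∈ {w : Site 2 | triMeshPoint δ w ∈ Φ '' {z : ℂ | yin ≤ z.im}},
              B ∈ siteConnIn triGraph {w | triMeshPoint δ w ∈ Φ '' (Icc (-x) x ×ℂ Icc (-yout) yout)} u v) →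
          ∃ u ∈ {w : Site 2 | triMeshPoint δ w ∈ Φ '' {z : ℂ | z.re ≤ -(x - 2 * ν)}},
            ∃ v ∈ {w : Site 2 | triMeshPoint δ w ∈ Φ '' {z : ℂ | x - 2 * ν ≤ z.re}},
              Bᶜ ∈ siteConnIn triGraph
                {w | triMeshPoint δ w ∈ Φ '' (Icc (-x) x ×ℂ Icc (-(yin + 2 * ν)) (yin + 2 * ν))} u v := by
      intro B hno
      rcases hV δ hδ hδ₁' B (x - ν) (yin + ν) (by linarith) (by linarith) (by linarith) (by linarith) with
        ⟨u, w, hu, hw, hp⟩ | ⟨u, w, hu, hw, hp⟩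
      · refine absurd ⟨u, mem_image_of_symm_mem ?_, w, mem_image_of_symm_mem ?_,
          mem_siteConnIn_of_pathIn hbox₁ hp⟩ hno
        · show (Φ.symm (triMeshPoint δ u)).im ≤ -yin
          linarith
        · show yin ≤ (Φ.symm (triMeshPoint δ w)).im
          linarith
      · refine ⟨u, mem_image_of_symm_mem ?_, w, mem_image_of_symm_mem ?_, mem_siteConnIn_of_pathIn hbox₂ hp⟩
        · show (Φ.symm (triMeshPoint δ u)).re ≤ -(x - 2 * ν)
          linarith
        · show x - 2 * ν ≤ (Φ.symm (triMeshPoint δ w)).re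
          linarith
    exact ⟨key ω, fun hno => by simpa only [compl_compl] using key ωᶜ hno⟩
  · -- horizontal hypothesis, vertical conclusion
    have hδ₂' : δ ≤ δ₂ := hδle.trans (min_le_right _ _)
    have hbox₁ : Icc (-(xin + ν) - ν) (xin + ν + ν) ×ℂ Icc (-(y - ν) - ν) (y - ν + ν) ⊆
        Icc (-xout) xout ×ℂ Icc (-y) y := fun z hz =>
      ⟨⟨by linarith [hz.1.1], by linarith [hz.1.2]⟩, ⟨by linarith [hz.2.1], by linarith [hz.2.2]⟩⟩
    have hbox₂ : Icc (-(xin + ν) - ν) (xin + ν + ν) ×ℂ Icc (-(y - ν) - ν) (y - ν + ν) ⊆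
        Icc (-(xin + 2 * ν)) (xin + 2 * ν) ×ℂ Icc (-y) y := fun z hz =>
      ⟨⟨by linarith [hz.1.1], by linarith [hz.1.2]⟩, ⟨by linarith [hz.2.1], by linarith [hz.2.2]⟩⟩
    have key : ∀ B : Set (Site 2),
        (¬ ∃ u ∈ {w : Site 2 | triMeshPoint δ w ∈ Φ '' {z : ℂ | z.re ≤ -xin}},
            ∃ v ∈ {w : Site 2 | triMeshPoint δ w ∈ Φ '' {z : ℂ | xin ≤ z.re}},
              B ∈ siteConnIn triGraph {w | triMeshPoint δ w ∈ Φ '' (Icc (-xout) xout ×ℂ Icc (-y) y)} u v) →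
          ∃ u ∈ {w : Site 2 | triMeshPoint δ w ∈ Φ '' {z : ℂ | z.im ≤ -(y - 2 * ν)}},
            ∃ v ∈ {w : Site 2 | triMeshPoint δ w ∈ Φ '' {z : ℂ | y - 2 * ν ≤ z.im}},
              Bᶜ ∈ siteConnIn triGraph
                {w | triMeshPoint δ w ∈ Φ '' (Icc (-(xin + 2 * ν)) (xin + 2 * ν) ×ℂ Icc (-y) y)} u v := by
      intro B hno
      rcases hH δ hδ hδ₂' B (xin + ν) (y - ν) (by linarith) (by linarith) (by linarith) (by linarith) with
        ⟨u, w, hu, hw, hp⟩ | ⟨u, w, hu, hw, hp⟩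
      · refine absurd ⟨u, mem_image_of_symm_mem ?_, w, mem_image_of_symm_mem ?_,
          mem_siteConnIn_of_pathIn hbox₁ hp⟩ hno
        · show (Φ.symm (triMeshPoint δ u)).re ≤ -xin
          linarith
        · show xin ≤ (Φ.symm (triMeshPoint δ w)).re
          linarith
      · refine ⟨u, mem_image_of_symm_mem ?_, w, mem_image_of_symm_mem ?_, mem_siteConnIn_of_pathIn hbox₂ hp⟩
        · show (Φ.symm (triMeshPoint δ u)).im ≤ -(y - 2 * ν)
          linarith
        · show y - 2 * ν ≤ (Φ.symm (triMeshPoint δ w)).im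
          linarith
    exact ⟨key ω, fun hno => by simpa only [compl_compl] using key ωᶜ hno⟩

end Summit.CriticalPhenomena.CardyFormulaZ2.Cruxes.LoopsToCrossings.OracleSandwich

end
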